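import Summits.BirchSwinnertonDyer.BirchSwinnertonDyer.Theorems.QuadraticBranchSignedControlPlusEtaNonsurjCartanField
import Summits.BirchSwinnertonDyer.Rank1Residual.Additive.FouquetWanLocus
import Literature.NumberTheory.EllipticCurves.BSDSelmerPConverseRamifiedProofs
import HarnessLib

/-!
# Route `QuadraticBranchSignedControl` (rung K8, cell `bsd-potss`): crux stmt-BirchSwinnertonDyer-19606
# `PlusEtaMainConjectureNonsurj` — NO STEINBERG HANDLE: on every row, `p ∣ v_ℓ(Δ_min)` at every multiplicative
# prime `ℓ ≠ p` (`ρ̄_{V,p}` is unramified there), so the Fouquet–Wan shape `FWNonsplitRam V p` fails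

WHAT. The second in-print / in-preprint handle for an INTEGRAL main conjecture at a non-ordinary prime is the
Fouquet–Wan shape (arXiv:2107.13726, Thm. 1.1, third hypothesis: «there exists `ℓ ∤ p` with `ℓ ∥ N`, `dim ρ̄^{I_ℓ} = 1` and
`dim ρ̄^{G_{ℚ_ℓ}} = 0`» — a multiplicative prime at which `ρ̄` is RAMIFIED), typed by the cell as the predicate
`Additive.FWNonsplitRam W p` (`∃ q ≠ p` multiplicative, non-split, `p ∤ v_q(Δ_min)`) and used on the tower-ONTO locus of
crux 19242. By the theory of the Tate curve, inertia at a multiplicative `ℓ ≠ p` acts on `V[p]` UNIPOTENTLY, and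
non-trivially iff `p ∤ v_ℓ(Δ_min)` (Silverman, *ATAEC* V.4–V.5, Ex. 5.13 (b); tree theorems
`exists_inertia_smul_ne_of_hasMultiplicativeReductionAtPrime`, `exists_unipotent_of_hasMultiplicativeReductionAt` of the
bsd.S25 lane). On a row of crux 19606 no element of `Γ_ℚ` acts on `V[p]` as a non-trivial transvection
(`EtaCartanField.smul_eq_self_of_transvection_of_row`, p567491). Hence:

* `dvd_padicValInt_minimalDiscriminant_of_hasMultiplicativeReduction_of_row` — **on every row of 19606 (`V/ℚ` globally
  minimal, `p ≥ 5` good, `a_p = 0`, `p`-adic tower not onto) and every prime `ℓ ≠ p` of multiplicative reduction,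
  `p ∣ v_ℓ(Δ_min(V))`** (`ρ̄_{V,p}` is unramified at `ℓ`; FINDING-19606-k8eta-c2-g5 §2 (h) «ρ̄ unramified forces
  `5 ∣ v_ℓ(Δ)`» as a theorem);
* `not_fwNonsplitRam_of_row` — **`¬ FWNonsplitRam V p`**: the Fouquet–Wan Steinberg hypothesis fails for the row (for the
  partner `W = V ⊗ χ_{p*}` as well, `ρ̄_W = ρ̄_V ⊗ η̄` with `η` unramified at `ℓ ≠ p` — not restated here).
Together with `…KatoClauseThreeIdle` (p571345: Kato's Thm. 13.4 clause (3) is unsatisfiable on every row) this makes the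
crux's `why_might_fail` («the non-surjective rows keep the `pⁿ`-slack; no Euler-system equality in print») a pair of
KERNEL theorems about the two available integral handles.

HONEST FRAMING (cell `bsd-potss`, run/shared/lean/pub/bsd-potss/; FULL-BSD rank ≤ 1 programme): TOOL THEOREMS ONLY (no
definition, no named fact, no `sorry`, axioms standard); the local-to-global steps are those of
`hasSurjectiveModNGaloisRep_pow_of_hasMultiplicativeReductionAtPrime` (bsd.S25). Nothing is booked; crux 19606 stays
OPEN; `BSD(W, p)` is claimed for no pair. Seat `bsd-potss-k8eta-c2` g9 (prover), `--supports stmt-BirchSwinnertonDyer-19606`.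

References: [SilvermanATAEC1994] V.4–V.5, Exercise 5.13 (b); [SerreAbelianLadic1968] Ch. IV A.1.2; [Serre1972] §2.2;
O. Fouquet, X. Wan, arXiv:2107.13726, Thm. 1.1 (third hypothesis).
-/

set_option autoImplicit false
set_option linter.dupNamespace false

noncomputable section

open scoped Classical NNReal

open NumberField IsDedekindDomain Field WeierstrassCurve Literature.NumberTheory.EllipticCurves
  Literature.NumberTheory.SerreUniformity Summit.BirchSwinnertonDyer.Rank1Residual.Additive

namespace Summit.BirchSwinnertonDyer.BirchSwinnertonDyer.Theorems.EtaCartanField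

/-- **No Steinberg handle on a row of crux 19606.** For `V/ℚ` globally minimal, `p ≥ 5` good with `a_p = 0` and `p`-adic
tower NOT onto, every prime `ℓ ≠ p` of multiplicative reduction has `p ∣ v_ℓ(Δ_min(V))`: otherwise the Tate curve gives a
`σ ∈ Γ_ℚ` acting on `V[p]` unipotently and non-trivially (`exists_inertia_smul_ne_of_hasMultiplicativeReductionAtPrime`,
`exists_unipotent_of_hasMultiplicativeReductionAt`), i.e. a non-trivial transvection — impossible on an `X_ns⁺(p)` row
(`smul_eq_self_of_transvection_of_row`). [cite: SilvermanATAEC1994, V.4–V.5 and Exercise 5.13 (b)]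
[cite: Serre1972, §2.2] -/
theorem dvd_padicValInt_minimalDiscriminant_of_hasMultiplicativeReduction_of_row (V : WeierstrassCurve ℚ)
    [V.IsElliptic] [V.IsGloballyMinimal] (p : ℕ) [Fact p.Prime] (hp5 : 5 ≤ p)
    (hgood : V.HasGoodReductionAtPrime p) (hap : V.frobeniusTrace p = 0)
    (hns : ¬ ∀ m : ℕ, V.HasSurjectiveModNGaloisRep (p ^ m : ℕ)) (ℓ : ℕ) [hℓ : Fact ℓ.Prime] (hℓp : ℓ ≠ p)
    (hmult : V.HasMultiplicativeReductionAtPrime ℓ) : p ∣ padicValInt ℓ V.minimalDiscriminantInt := by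
  have hp : p.Prime := Fact.out
  by_contra hdiv
  -- the place `v` of `ℚ` at `ℓ` and the local data there (as in bsd.S25's
  -- `hasSurjectiveModNGaloisRep_pow_of_hasMultiplicativeReductionAtPrime`)
  set v : HeightOneSpectrum (𝓞 ℚ) :=
    (Rat.HeightOneSpectrum.primesEquiv (R := 𝓞 ℚ)).symm ⟨ℓ, hℓ.out⟩ with hvdef
  have hv : Rat.HeightOneSpectrum.primesEquiv v = ⟨ℓ, hℓ.out⟩ := Equiv.apply_symm_apply _ _
  have hvℓ : (Rat.HeightOneSpectrum.primesEquiv v : ℕ) = ℓ := congrArg Subtype.val hv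
  obtain ⟨w, hw⟩ := v.exists_spectralValuation
  obtain ⟨𝔐, h𝔐⟩ := v.localPrimesAbove_nonempty
  have hmult_v : haveI := Fact.mk (Rat.HeightOneSpectrum.primesEquiv v).2;
      V.HasMultiplicativeReductionAtPrime (Rat.HeightOneSpectrum.primesEquiv v) := by
    have key : ∀ (q : ℕ) (hq : Fact q.Prime), q = ℓ →
        @WeierstrassCurve.HasMultiplicativeReductionAtPrime V q hq := by
      rintro q hq rfl; exact hmult
    exact key _ _ hvℓ
  have hram_v : ¬ p ∣ padicValNat (Rat.HeightOneSpectrum.primesEquiv v) V.minimalDiscriminantInt.natAbs := by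
    rw [hvℓ]; exact hdiv
  have hℓp' : (Rat.HeightOneSpectrum.primesEquiv v : ℕ) ≠ p := by rw [hvℓ]; exact hℓp
  have hloc := V.exists_inertia_smul_ne_of_hasMultiplicativeReductionAtPrime v hp hℓp' hmult_v hram_v hw h𝔐
  have hmultAt : V.HasMultiplicativeReductionAt v :=
    (WeierstrassCurve.hasMultiplicativeReductionAtPrime_iff_hasMultiplicativeReductionAt_ringOfIntegers V v).mp
      hmult_v
  have hpv : (p : 𝓞 ℚ) ∉ v.asIdeal := by
    intro hmem
    have hv' := (natCast_mem_asIdeal_iff_eq_primesEquiv_symm v hp).mp hmem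
    apply hℓp'
    rw [hv', Equiv.apply_symm_apply]
  -- a GLOBAL `σ` acting on `V[p]` unipotently and non-trivially
  have hU := V.exists_unipotent_of_hasMultiplicativeReductionAt hmultAt hp hpv (le_refl 1) hw h𝔐 hloc
  rw [pow_one] at hU
  obtain ⟨σ, hσ, Q, -, hσQ⟩ := hU
  -- on an `X_ns⁺(p)` row a unipotent `σ` acts trivially on `V[p]`
  refine hσQ (smul_eq_self_of_transvection_of_row V p hp5 hgood hap hns (σ := σ) (fun P => ?_) Q)
  have h1 := hσ P
  rw [smul_sub] at h1
  exact sub_eq_sub_iff_add_eq_add.mp h1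

/-- **The Fouquet–Wan Steinberg shape fails on every row of crux 19606**: `¬ FWNonsplitRam V p` (no multiplicative
`q ≠ p` with `p ∤ v_q(Δ_min)`). [cite: SilvermanATAEC1994, V.4–V.5 and Exercise 5.13 (b)] [cite: Serre1972, §2.2] -/
theorem not_fwNonsplitRam_of_row (V : WeierstrassCurve ℚ) [V.IsElliptic] [V.IsGloballyMinimal] (p : ℕ) [Fact p.Prime]
    (hp5 : 5 ≤ p) (hgood : V.HasGoodReductionAtPrime p) (hap : V.frobeniusTrace p = 0)
    (hns : ¬ ∀ m : ℕ, V.HasSurjectiveModNGaloisRep (p ^ m : ℕ)) : ¬ FWNonsplitRam V p := by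
  rintro ⟨q, hq, hqp, hmult, -, hdiv⟩
  exact hdiv (dvd_padicValInt_minimalDiscriminant_of_hasMultiplicativeReduction_of_row V p hp5 hgood hap hns q hqp
    hmult)

end Summit.BirchSwinnertonDyer.BirchSwinnertonDyer.Theorems.EtaCartanField

end
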